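import Mathlib
import HarnessLib

/-!
# Friedlander–Iwaniec, *The polynomial `X² + Y⁴` captures its primes*, §12 (12.13)–(12.14), `y`-side:
# a smooth dyadic majorant `f` and its `L¹` Mellin kernel

[FI, §12, p. 46 and (12.13)–(12.14), arXiv:math/9811185 = Ann. of Math. 148 (1998) 945–1040]:
"We begin by attaching to `V(D)` a smooth majorant `f(y)` supported on `½D ≤ y ≤ 3D` […]
we represent `B(x, y)` as the Fourier–Mellin transform in `x` and `y` respectively,
(12.13) `f(|x|y) g(|x|) = ∬ h(u,t) e(ux) y^{it} du dt` […] Integrating the Mellin transform by parts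
four times we get `∫₀^∞ f(y) y^{-1-it} dy ≪ (t²+1)^{-2}`" — the `y`-variable is separated
MULTIPLICATIVELY (`y^{it} = r₁^{it} r₂^{it} q^{-it} …`), with a kernel that is integrable against any
fixed power of `t`.  The same device separates `f(|Δ|/ed)` in §16 (p. 54: "we use the same technique as
in Section 12").

This file PROVES the `y`-side of that device once and for all, in Mathlib's Fourier currency (the Mellin
transform of `f` at `s = -it` is the Fourier transform of `v ↦ f(e^v)`; "integration by parts four
times" becomes "a smooth compactly supported function is Schwartz, so its Fourier transform is
integrable against every power"):

* `exists_smooth_dyadic_majorant` — a `C^∞` function `F : ℝ → [0,1]` with `F = 1` on `[1,2]` and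
  `F = 0` outside `(½, 5/2)` (Mathlib's `ContDiffBump`); `f(y) = F(y/D)` is then the printed majorant
  of `1_{D < y ≤ 2D}` supported on `½D ≤ y ≤ 3D`.
* `exists_majorant_mellinKernel` — **the separation kernel**: such an `F` together with a continuous
  `M : ℝ → ℂ` with `∫ |t|^k |M(t)| dt < ∞` for EVERY `k` (so in particular `∫ (1+t²)|M| < ∞`, the
  printed `(t²+1)^{-2}` decay in integrated form) and
  `F(w) = ∫ M(t) e^{2πi t log w} dt = ∫ M(t) w^{2πit} dt` for all `w > 0`.
  Hence `f(|x|y) = F(|x|y/D) = ∫ M(t) |x|^{2πit} y^{2πit} D^{-2πit} dt`: the variables in `y = c r₁r₂/q`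
  separate as unimodular factors `r₁^{2πit}`, `r₂^{2πit}`, `q^{-2πit}`.

No definitions, no named facts.  (HOME/parity-ideate-lit/FI98-Prop121-MAP.md, step 6, `y`-side.)

## References
* J. Friedlander, H. Iwaniec, Ann. of Math. (2) 148 (1998) 945–1040, §12 (12.6), (12.13), (12.14).
  [cite: FriedlanderIwaniecAnnals1998, §12 (12.13)–(12.14)]

## Mathlib
`ContDiffBump` (`one_of_mem_closedBall`, `zero_of_le_dist`, `nonneg`, `le_one`, `contDiff`),
`HasCompactSupport.toSchwartzMap`, `SchwartzMap.integrable_pow_mul`, the Schwartz Fourier transform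
(`SchwartzMap.fourier_coe`) and `Continuous.fourierInv_fourier_eq` (Fourier inversion), `Real.fourierInv_eq'`.
-/

noncomputable section

open Real Complex MeasureTheory Set Filter
open scoped FourierTransform ContDiff

namespace Literature.NumberTheory.Sieve.FriedlanderIwaniecPrimes

/-- **A smooth dyadic majorant.** There is a `C^∞` function `F : ℝ → ℝ` with `0 ≤ F ≤ 1`, `F = 1` on
`[1, 2]`, and `F(w) = 0` for `w ≤ ½` and for `w ≥ 5/2`; so `f(y) = F(y/D) ≥ 1_{(D,2D]}(y)` is "a smooth
majorant supported on `½D ≤ y ≤ 3D`". [cite: FriedlanderIwaniecAnnals1998, §12 (12.6)] -/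
theorem exists_smooth_dyadic_majorant :
    ∃ F : ℝ → ℝ, ContDiff ℝ ∞ F ∧ (∀ w, 0 ≤ F w) ∧ (∀ w, F w ≤ 1) ∧ (∀ w ∈ Icc (1 : ℝ) 2, F w = 1) ∧
      (∀ w, w ≤ 1 / 2 → F w = 0) ∧ (∀ w, 5 / 2 ≤ w → F w = 0) := by
  let b : ContDiffBump (3 / 2 : ℝ) := ⟨1 / 2, 1, by norm_num, by norm_num⟩
  refine ⟨b, b.contDiff, fun w => b.nonneg, fun w => b.le_one, ?_, ?_, ?_⟩
  · intro w hw
    rw [mem_Icc] at hw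
    apply b.one_of_mem_closedBall
    rw [Metric.mem_closedBall, Real.dist_eq]
    show |w - 3 / 2| ≤ 1 / 2
    rw [abs_le]
    constructor <;> linarith
  · intro w hw
    apply b.zero_of_le_dist
    rw [Real.dist_eq]
    show (1 : ℝ) ≤ |w - 3 / 2|
    rw [abs_of_neg (by linarith)]
    linarith
  · intro w hw
    apply b.zero_of_le_dist
    rw [Real.dist_eq]
    show (1 : ℝ) ≤ |w - 3 / 2|
    rw [abs_of_pos (by linarith)]
    linarith

/-- **The `y`-side separation kernel of (12.13)–(12.14).**  There are a smooth dyadic majorant `F`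
(as in `exists_smooth_dyadic_majorant`) and a continuous kernel `M : ℝ → ℂ`, integrable against every
power `|t|^k`, with `F(w) = ∫ M(t) e^{2πi t log w} dt` (`= ∫ M(t) w^{2πit} dt`) for every `w > 0`.
(`M` is the Fourier transform of the Schwartz function `v ↦ F(e^v)`, i.e. the Mellin transform of `F`
on the line `Re s = 0`; "integrating by parts four times, `≪ (t²+1)^{-2}`" is the case `k ≤ 2` of the
integrability.) [cite: FriedlanderIwaniecAnnals1998, §12 (12.13)–(12.14)] -/
theorem exists_majorant_mellinKernel :
    ∃ (F : ℝ → ℝ) (M : ℝ → ℂ), ContDiff ℝ ∞ F ∧ (∀ w, 0 ≤ F w) ∧ (∀ w, F w ≤ 1) ∧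
      (∀ w ∈ Icc (1 : ℝ) 2, F w = 1) ∧ (∀ w, w ≤ 1 / 2 → F w = 0) ∧ (∀ w, 5 / 2 ≤ w → F w = 0) ∧
      Continuous M ∧ (∀ k : ℕ, Integrable (fun t : ℝ => |t| ^ k * ‖M t‖)) ∧
      ∀ w : ℝ, 0 < w →
        (F w : ℂ) = ∫ t : ℝ, M t * Complex.exp (2 * π * I * t * Real.log w) := by
  obtain ⟨F, hF, h0, h1, hone, hlow, hhigh⟩ := exists_smooth_dyadic_majorant
  -- `Φ = F ∘ exp`, complex-valued: smooth with compact support, hence Schwartz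
  set Φ : ℝ → ℂ := fun v => ((F (Real.exp v) : ℝ) : ℂ) with hΦ
  have hΦsmooth : ContDiff ℝ ∞ Φ :=
    ofRealCLM.contDiff.comp (hF.comp Real.contDiff_exp)
  have hΦsupp : HasCompactSupport Φ := by
    refine HasCompactSupport.of_support_subset_isCompact
      (isCompact_Icc : IsCompact (Icc (Real.log (1 / 2)) (Real.log (5 / 2)))) ?_
    intro v hv
    rw [Function.mem_support] at hv
    by_contra hv'
    rw [mem_Icc, not_and_or, not_le, not_le] at hv'
    apply hv
    simp only [hΦ, Complex.ofReal_eq_zero]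
    rcases hv' with h | h
    · apply hlow
      have := Real.exp_lt_exp.2 h
      rw [Real.exp_log (by norm_num)] at this
      exact this.le
    · apply hhigh
      have := Real.exp_lt_exp.2 h
      rw [Real.exp_log (by norm_num)] at this
      exact this.le
  set S : SchwartzMap ℝ ℂ := hΦsupp.toSchwartzMap hΦsmooth with hSdef
  have hS : ∀ v, S v = Φ v := fun v => rfl
  -- the kernel: the Fourier transform of `S`
  set T : SchwartzMap ℝ ℂ := 𝓕 S with hTdef
  have hT : (T : ℝ → ℂ) = 𝓕 (S : ℝ → ℂ) := SchwartzMap.fourier_coe S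
  refine ⟨F, T, hF, h0, h1, hone, hlow, hhigh, T.continuous, fun k => ?_, fun w hw => ?_⟩
  · have := T.integrable_pow_mul volume k
    refine this.congr (Eventually.of_forall fun t => ?_)
    simp only [Real.norm_eq_abs]
  · -- Fourier inversion for the Schwartz function `S`, evaluated at `v = log w`
    have hinv : 𝓕⁻ (𝓕 (S : ℝ → ℂ)) = (S : ℝ → ℂ) :=
      S.continuous.fourierInv_fourier_eq S.integrable (by rw [← hT]; exact T.integrable)
    have hval : (F w : ℂ) = S (Real.log w) := by
      rw [hS, hΦ]
      simp only [Real.exp_log hw]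
    rw [hval, ← congrFun hinv (Real.log w), Real.fourierInv_eq', ← hT]
    refine integral_congr_ae (Eventually.of_forall fun t => ?_)
    simp only [smul_eq_mul, RCLike.inner_apply, conj_trivial]
    rw [mul_comm (T t)]
    congr 1
    push_cast
    ring_nf
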